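import Summits.HodgeConjecture.HodgeConjecture.Theses.ELineTransport
import Summits.HodgeConjecture.HodgeConjecture.Theorems.NikulinTwinTransportRealMultiplicationOfHodgeConjecture
import Literature.AlgebraicGeometry.Surfaces.K3Marking

/-!
# Birth skeleton — `ELineTransport.EClassOfSquareHodge` (stmt-HodgeConjecture-19048), piece X₂ of the
# BC2 redirect of `IsogenyInvariance` (stmt-HodgeConjecture-12550)

LINE `birth` (crux-strategist): the piece is the K3-square Künneth converse "HC(S ⊗ S) ⟹ the class of an
E-structure `J` is induced by an algebraic class", and the sibling route's LANDED engine
`Theorems.NikulinTwinTransport.hodgeEndomorphisms_induced_of_hodgeConjectureFor_square` proves exactly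
this conclusion for every RATIONAL TYPE-PRESERVING endomorphism of `H²(S(ℂ); ℂ)`, granted the marking
fact. Two stubs remain:

* `stub_typePreserving_of_EStructure` — an E-structure (rational, `J ∘ J = m`, cup-self-adjoint,
  `+√m` on `H^{2,0}`) preserves every Hodge type `(i, j)` of `H²` of a projective K3 surface
  (reality of `J` gives `J σ̄ = √m σ̄`; self-adjointness gives `J H^{1,1} ⟂ σ, σ̄`, i.e.
  `J H^{1,1} ⊆ H^{1,1}` by the K3 Hodge types `Huybrechts_K3_hodgeTypes_H2_holds`; types outside
  `{(2,0),(1,1),(0,2)}` carry only `0`);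
* `stub_K3_marking` — the named fact `Huybrechts_K3_marking_exists` (Huybrechts Ch. 1 Prop. 3.5;
  reduced in tree to `b₂ = 22` + the orientation/signature/Hodge–Riemann/ample clause,
  `K3LatticeInvariants.Huybrechts_K3_marking_exists_holds_of`).

`EClassOfSquareHodge_of : EClassOfSquareHodge` is the kernel-checked composition, the stubs used by name
(degrees `2 * 1` of the engine and `2` of the route decl agree by `rfl`).
-/

namespace Summit.HodgeConjecture.HodgeConjecture.Cruxes.EClassOfSquareHodge.Birth

set_option linter.dupNamespace false

open scoped Manifold
open CategoryTheory AlgebraicGeometry MonoidalCategory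
open Literature.AlgebraicGeometry.Motives Literature.AlgebraicGeometry.HodgeTheory
open Literature.AlgebraicGeometry.Surfaces
open Literature.AlgebraicTopology.SingularHomology
open Summit.HodgeConjecture.HodgeConjecture.Theses.ELineTransport

/-- STUB (M): **E-structures preserve Hodge types.** For a projective K3 surface `S` (the route's K3
clause verbatim) and an E-structure `J` on `H²(S(ℂ); ℂ)` — rational, `J ∘ J = m`, cup-self-adjoint,
`J = +√m` on `H^{2,0}` — `J` maps classes of type `(i, j)` to classes of type `(i, j)`, all `i j`.
[cite: Huybrechts2016K3, Ch. 3 §2–3] [cite: Zarhin1983HodgeGroupsK3, §1] -/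
theorem stub_typePreserving_of_EStructure :
    ∀ (S : SchemeOver ℂ), (IsSmoothProjective 2 S ∧ Subsingleton (structureSheafCohomology S.left 1) ∧
      ∃ (A : HodgeModel 2 S) (η : Literature.Geometry.Kaehler.MForm 𝓘(ℝ, A.model) A.carrier ℂ 2),
        Literature.Geometry.Kaehler.IsHolomorphicInCharts η ∧ ∀ x, η x ≠ 0) →
    ∀ m : ℕ, ¬ IsSquare m → ∀ J : complexBetti S 2 →ₗ[ℂ] complexBetti S 2,
      ((∀ c, IsRationalClass c → IsRationalClass (J c)) ∧ (∀ c, J (J c) = (m : ℂ) • c) ∧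
        (∀ a b, cupProduct rfl (J a) b = cupProduct rfl a (J b)) ∧
        (∀ c, IsOfHodgeType 2 S 2 2 0 c → J c = (Real.sqrt m : ℂ) • c)) →
      ∀ (i j : ℕ) (x : complexBetti S 2), IsOfHodgeType 2 S 2 i j x → IsOfHodgeType 2 S 2 i j (J x) := by
  sorry

/-- STUB (named fact, L): **markings of projective K3 surfaces exist** — Huybrechts Ch. 1 Prop. 3.5
(`H²(X, ℤ) ≅ Λ_K3` with its intersection form), in the tree's rendering `Huybrechts_K3_marking_exists`.
[cite: Huybrechts2016K3, Ch. 1 Prop. 3.5] -/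
theorem stub_K3_marking : Huybrechts_K3_marking_exists := by
  sorry

/-- **X₂ from the two stubs** (used by name inside the proof; sorries live only in `stub_*`):
`HodgeConjectureFor 4 (S ⊗ S)` makes the class of an E-structure algebraic — the sibling engine applied
to `G := J`, type preservation from `stub_typePreserving_of_EStructure`, markings from `stub_K3_marking`.
[cite: Varesco2023, §2 (p. 8)] [cite: VoisinHodgeI2002, §11.3.3 Lemma 11.41] -/
theorem EClassOfSquareHodge_of : EClassOfSquareHodge := by
  intro μ hμ S hS m hm J hJ hHC
  exact Theorems.NikulinTwinTransport.hodgeEndomorphisms_induced_of_hodgeConjectureFor_square stub_K3_marking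
    μ S hS hHC J hJ.1 (stub_typePreserving_of_EStructure S hS m hm J hJ)

end Summit.HodgeConjecture.HodgeConjecture.Cruxes.EClassOfSquareHodge.Birth
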